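import Summits.AtomisticToContinuum.Crystallization.Theorems.ChargedEnergyGapStressFreeCubicA
import HarnessLib

/-!
# «StressFreeCubic» P-I(3/3) (lens-3 g61) — part 2 of 2 (sequel of `…ChargedEnergyGapStressFreeCubicA`)

Split for the 400-line cap by the landing lane (hand-2 g31); the module docstring of part 1 (`…ChargedEnergyGapStressFreeCubicA`) describes the whole node.  Same namespace; all FQNs unchanged.
0 sorry; standard axioms.
-/

noncomputable section
open scoped Classical
open Literature.MathematicalPhysics.StatisticalMechanics
open Literature.Geometry.DiscreteGeometry
open Summit.AtomisticToContinuum.Crystallization.Theses.PricedLinkCensus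
open Summit.AtomisticToContinuum.Crystallization.Theorems.ChargedEnergyGapNegative

namespace Summit.AtomisticToContinuum.Crystallization.Theorems.ChargedEnergyGapChartDial

namespace Cubic

/-! ## The virial sums on `ℤ³ ∖ 0` -/

section Sums

/-- The radial pair function `F(d) = V′(d)/d`. -/
def F (d : ℝ) : ℝ := ljD1 d / d

/-- `F_mul_sq` (docstring added by the landing lane; see the module docstring). [formal bookkeeping] -/
theorem F_mul_sq {d : ℝ} (hd : 0 < d) : F d * d ^ 2 = -(d⁻¹) ^ 12 + (d⁻¹) ^ 6 := by
  unfold F ljD1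
  field_simp

/-- `abs_F_mul_sq_le` (docstring added by the landing lane; see the module docstring). [formal bookkeeping] -/
theorem abs_F_mul_sq_le {d : ℝ} (hd : 0 < d) : |F d| * d ^ 2 ≤ (d⁻¹) ^ 12 + (d⁻¹) ^ 6 := by
  have h : |F d| * d ^ 2 = |F d * d ^ 2| := by
    rw [abs_mul, abs_of_pos (pow_pos hd 2)]
  rw [h, F_mul_sq hd]
  have h1 : 0 ≤ (d⁻¹) ^ 12 := pow_nonneg (inv_nonneg.2 hd.le) _
  have h2 : 0 ≤ (d⁻¹) ^ 6 := pow_nonneg (inv_nonneg.2 hd.le) _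
  exact (abs_add_le _ _).trans (by rw [abs_neg, abs_of_nonneg h1, abs_of_nonneg h2])

/-- The length of the lattice point `a·n`. -/
def len (a : ℝ) (n : N3) : ℝ := a * Real.sqrt (nsq n.1)

/-- `len_pos` (docstring added by the landing lane; see the module docstring). [formal bookkeeping] -/
theorem len_pos (a : ℝ) (ha : 0 < a) (n : N3) : 0 < len a n := mul_pos ha (Real.sqrt_pos.2 (nsq_pos n))

/-- `abs_coord_le_len` (docstring added by the landing lane; see the module docstring). [formal bookkeeping] -/
theorem abs_coord_le_len (a : ℝ) (ha : 0 < a) (n : N3) (i : Fin 3) : |((n.1 i : ℝ)) * a| ≤ len a n := by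
  have h := PiLp.norm_apply_le (vec a n.1) i
  rw [vec_apply, Real.norm_eq_abs, norm_vec a ha] at h
  exact h

/-- The `(i, j)` summand of the virial on `ℤ³ ∖ 0`. -/
def term (a : ℝ) (i j : Fin 3) (n : N3) : ℝ := F (len a n) * (((n.1 i : ℝ) * a) * ((n.1 j : ℝ) * a))

/-- The `(i, j)` entry of the virial tensor of the cubic lattice `a·ℤ³` (one-point motif). -/
def S (a : ℝ) (i j : Fin 3) : ℝ := ∑' n : N3, term a i j n

/-- `summable_inv_len_pow` (docstring added by the landing lane; see the module docstring). [formal bookkeeping] -/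
theorem summable_inv_len_pow (a : ℝ) (ha : 0 < a) {p : ℕ} (hp : 3 < p) : Summable fun n : N3 => ((len a n)⁻¹) ^ p := by
  have h := (cubicRef a ha).summable_inv_pow_dist hp (0 : E3)
  rw [← (vecEquiv a ha).summable_iff] at h
  refine h.congr fun n => ?_
  simp only [Function.comp_apply, vecEquiv_apply, dist_zero_vec a ha]
  rfl

/-- `abs_term_le` (docstring added by the landing lane; see the module docstring). [formal bookkeeping] -/
theorem abs_term_le (a : ℝ) (ha : 0 < a) (i j : Fin 3) (n : N3) : |term a i j n| ≤ ((len a n)⁻¹) ^ 12 + ((len a n)⁻¹) ^ 6 := by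
  have hd := len_pos a ha n
  have hi := abs_coord_le_len a ha n i
  have hj := abs_coord_le_len a ha n j
  have h1 : |term a i j n| ≤ |F (len a n)| * (len a n) ^ 2 := by
    unfold term
    rw [abs_mul, abs_mul, sq]
    exact mul_le_mul_of_nonneg_left (mul_le_mul hi hj (abs_nonneg _) hd.le) (abs_nonneg _)
  exact h1.trans (abs_F_mul_sq_le hd)

/-- `summable_term` (docstring added by the landing lane; see the module docstring). [formal bookkeeping] -/
theorem summable_term (a : ℝ) (ha : 0 < a) (i j : Fin 3) : Summable (term a i j) :=
  Summable.of_norm_bounded ((summable_inv_len_pow a ha (by norm_num : 3 < 12)).add (summable_inv_len_pow a ha (by norm_num : 3 < 6)))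
    fun n => by rw [Real.norm_eq_abs]; exact abs_term_le a ha i j n

/-! ### Symmetries -/

/-- Negating the `i`-th coordinate. -/
def negCoord (i : Fin 3) (n : Fin 3 → ℤ) : Fin 3 → ℤ := fun k => if k = i then -n k else n k

/-- `negCoord_negCoord` (docstring added by the landing lane; see the module docstring). [formal bookkeeping] -/
theorem negCoord_negCoord (i : Fin 3) (n : Fin 3 → ℤ) : negCoord i (negCoord i n) = n := by
  funext k; by_cases hk : k = i <;> simp [negCoord, hk]

/-- `negCoord_ne_zero` (docstring added by the landing lane; see the module docstring). [formal bookkeeping] -/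
theorem negCoord_ne_zero (i : Fin 3) {n : Fin 3 → ℤ} (hn : n ≠ 0) : negCoord i n ≠ 0 := fun h =>
  hn (by rw [← negCoord_negCoord i n, h]; funext k; simp [negCoord])

/-- Coordinate negation as a permutation of `ℤ³ ∖ 0`. -/
def negEquiv (i : Fin 3) : N3 ≃ N3 where
  toFun n := ⟨negCoord i n.1, negCoord_ne_zero i n.2⟩
  invFun n := ⟨negCoord i n.1, negCoord_ne_zero i n.2⟩
  left_inv n := Subtype.ext (negCoord_negCoord i n.1)
  right_inv n := Subtype.ext (negCoord_negCoord i n.1)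

/-- `nsq_negCoord` (docstring added by the landing lane; see the module docstring). [formal bookkeeping] -/
theorem nsq_negCoord (i : Fin 3) (n : Fin 3 → ℤ) : nsq (negCoord i n) = nsq n := by
  unfold nsq negCoord
  refine Finset.sum_congr rfl fun k _ => ?_
  by_cases hk : k = i <;> simp [hk]

/-- `len_negEquiv` (docstring added by the landing lane; see the module docstring). [formal bookkeeping] -/
theorem len_negEquiv (a : ℝ) (i : Fin 3) (n : N3) : len a (negEquiv i n) = len a n := by
  simp [len, negEquiv, nsq_negCoord]

/-- `term_negEquiv` (docstring added by the landing lane; see the module docstring). [formal bookkeeping] -/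
theorem term_negEquiv {i j : Fin 3} (hij : i ≠ j) (a : ℝ) (n : N3) : term a i j (negEquiv i n) = -term a i j n := by
  simp only [term, len_negEquiv]
  simp [negEquiv, negCoord, hij.symm]

/-- ★ Off-diagonal virial entries vanish by the reflection symmetry. -/
theorem S_offDiag (a : ℝ) {i j : Fin 3} (hij : i ≠ j) : S a i j = 0 := by
  have h : S a i j = -S a i j := by
    calc S a i j = ∑' n : N3, term a i j (negEquiv i n) := ((negEquiv i).tsum_eq (term a i j)).symm
      _ = ∑' n : N3, -term a i j n := by simp_rw [term_negEquiv hij]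
      _ = -S a i j := tsum_neg
  linarith

/-- Swapping coordinates `0` and `i`. -/
def swapCoord (i : Fin 3) (n : Fin 3 → ℤ) : Fin 3 → ℤ := fun k => n (Equiv.swap 0 i k)

/-- `swapCoord_swapCoord` (docstring added by the landing lane; see the module docstring). [formal bookkeeping] -/
theorem swapCoord_swapCoord (i : Fin 3) (n : Fin 3 → ℤ) : swapCoord i (swapCoord i n) = n := by
  funext k; simp [swapCoord, Equiv.swap_apply_self]

/-- `swapCoord_ne_zero` (docstring added by the landing lane; see the module docstring). [formal bookkeeping] -/
theorem swapCoord_ne_zero (i : Fin 3) {n : Fin 3 → ℤ} (hn : n ≠ 0) : swapCoord i n ≠ 0 := fun h =>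
  hn (by rw [← swapCoord_swapCoord i n, h]; funext k; simp [swapCoord])

/-- Coordinate swap as a permutation of `ℤ³ ∖ 0`. -/
def swapEquiv (i : Fin 3) : N3 ≃ N3 where
  toFun n := ⟨swapCoord i n.1, swapCoord_ne_zero i n.2⟩
  invFun n := ⟨swapCoord i n.1, swapCoord_ne_zero i n.2⟩
  left_inv n := Subtype.ext (swapCoord_swapCoord i n.1)
  right_inv n := Subtype.ext (swapCoord_swapCoord i n.1)

/-- `nsq_swapCoord` (docstring added by the landing lane; see the module docstring). [formal bookkeeping] -/
theorem nsq_swapCoord (i : Fin 3) (n : Fin 3 → ℤ) : nsq (swapCoord i n) = nsq n := by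
  unfold nsq swapCoord
  exact Equiv.sum_comp (Equiv.swap 0 i) (fun k => ((n k : ℝ)) ^ 2)

/-- `len_swapEquiv` (docstring added by the landing lane; see the module docstring). [formal bookkeeping] -/
theorem len_swapEquiv (a : ℝ) (i : Fin 3) (n : N3) : len a (swapEquiv i n) = len a n := by
  simp [len, swapEquiv, nsq_swapCoord]

/-- `term_swapEquiv` (docstring added by the landing lane; see the module docstring). [formal bookkeeping] -/
theorem term_swapEquiv (a : ℝ) (i : Fin 3) (n : N3) : term a i i (swapEquiv i n) = term a 0 0 n := by
  simp only [term, len_swapEquiv]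
  simp [swapEquiv, swapCoord, Equiv.swap_apply_right]

/-- ★ Diagonal virial entries coincide by the coordinate-swap symmetry. -/
theorem S_diag_eq (a : ℝ) (i : Fin 3) : S a i i = S a 0 0 := by
  calc S a i i = ∑' n : N3, term a i i (swapEquiv i n) := ((swapEquiv i).tsum_eq (term a i i)).symm
    _ = S a 0 0 := by simp_rw [term_swapEquiv]; rfl

/-! ### The trace and the stress-free spacing -/

/-- `A = Σ |n|⁻¹²`, `B = Σ |n|⁻⁶` over `ℤ³ ∖ 0` (Epstein zeta values `Z(12)`, `Z(6)` of `ℤ³`). -/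
def epsteinA : ℝ := ∑' n : N3, ((len 1 n)⁻¹) ^ 12
/-- `epsteinB` (docstring added by the landing lane; see the module docstring). [formal bookkeeping] -/
def epsteinB : ℝ := ∑' n : N3, ((len 1 n)⁻¹) ^ 6

/-- `len_eq` (docstring added by the landing lane; see the module docstring). [formal bookkeeping] -/
theorem len_eq (a : ℝ) (n : N3) : len a n = a * len 1 n := by simp [len]

/-- `one_le_len_one` (docstring added by the landing lane; see the module docstring). [formal bookkeeping] -/
theorem one_le_len_one (n : N3) : 1 ≤ len 1 n := by
  rw [len, one_mul]
  calc (1 : ℝ) = Real.sqrt 1 := Real.sqrt_one.symm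
    _ ≤ Real.sqrt (nsq n.1) := Real.sqrt_le_sqrt (one_le_nsq n)

/-- The unit vector `e₀ ∈ ℤ³ ∖ 0`. -/
def e0 : N3 := ⟨fun k => if k = 0 then 1 else 0, fun h => by simpa using congrArg (fun f : Fin 3 → ℤ => f 0) h⟩

/-- `nsq_e0` (docstring added by the landing lane; see the module docstring). [formal bookkeeping] -/
theorem nsq_e0 : nsq e0.1 = 1 := by
  simp [nsq, e0]

/-- `len_one_e0` (docstring added by the landing lane; see the module docstring). [formal bookkeeping] -/
theorem len_one_e0 : len 1 e0 = 1 := by simp [len, nsq_e0]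

/-- `epsteinA_pos` (docstring added by the landing lane; see the module docstring). [formal bookkeeping] -/
theorem epsteinA_pos : 0 < epsteinA :=
  (summable_inv_len_pow 1 one_pos (by norm_num : 3 < 12)).tsum_pos (fun n => pow_nonneg (inv_nonneg.2 (len_pos 1 one_pos n).le) _) e0
    (by rw [len_one_e0]; norm_num)

/-- `epsteinB_pos` (docstring added by the landing lane; see the module docstring). [formal bookkeeping] -/
theorem epsteinB_pos : 0 < epsteinB :=
  (summable_inv_len_pow 1 one_pos (by norm_num : 3 < 6)).tsum_pos (fun n => pow_nonneg (inv_nonneg.2 (len_pos 1 one_pos n).le) _) e0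
    (by rw [len_one_e0]; norm_num)

/-- `epsteinA_le_epsteinB` (docstring added by the landing lane; see the module docstring). [formal bookkeeping] -/
theorem epsteinA_le_epsteinB : epsteinA ≤ epsteinB := by
  refine (summable_inv_len_pow 1 one_pos (by norm_num : 3 < 12)).tsum_le_tsum (fun n => ?_)
    (summable_inv_len_pow 1 one_pos (by norm_num : 3 < 6))
  have h0 : 0 ≤ (len 1 n)⁻¹ := inv_nonneg.2 (len_pos 1 one_pos n).le
  have h1 : (len 1 n)⁻¹ ≤ 1 := inv_le_one_of_one_le₀ (one_le_len_one n)
  exact pow_le_pow_of_le_one h0 h1 (by norm_num)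

/-- ★ The trace of the virial: `Σ_i S_ii(a) = −a⁻¹²·A + a⁻⁶·B`. -/
theorem S_trace (a : ℝ) (ha : 0 < a) : ∑ i, S a i i = -((a⁻¹) ^ 12 * epsteinA) + (a⁻¹) ^ 6 * epsteinB := by
  have hsum : ∀ n : N3, ∑ i, term a i i n = -((len a n)⁻¹) ^ 12 + ((len a n)⁻¹) ^ 6 := fun n => by
    have hq : ∑ i, ((n.1 i : ℝ) * a) * ((n.1 i : ℝ) * a) = (len a n) ^ 2 := by
      rw [len, mul_pow, Real.sq_sqrt (nsq_nonneg n.1), nsq, Finset.mul_sum]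
      exact Finset.sum_congr rfl fun i _ => by ring
    simp only [term]
    rw [← Finset.mul_sum, hq, F_mul_sq (len_pos a ha n)]
  simp only [S]
  rw [← Summable.tsum_finsetSum (fun i _ => summable_term a ha i i)]
  simp_rw [hsum]
  have h12 := summable_inv_len_pow a ha (by norm_num : 3 < 12)
  have h6 := summable_inv_len_pow a ha (by norm_num : 3 < 6)
  rw [h12.neg.tsum_add h6, tsum_neg]
  have e12 : ∑' n : N3, ((len a n)⁻¹) ^ 12 = (a⁻¹) ^ 12 * epsteinA := by
    rw [epsteinA, ← tsum_mul_left]; exact tsum_congr fun n => by rw [len_eq a n, mul_inv, mul_pow]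
  have e6 : ∑' n : N3, ((len a n)⁻¹) ^ 6 = (a⁻¹) ^ 6 * epsteinB := by
    rw [epsteinB, ← tsum_mul_left]; exact tsum_congr fun n => by rw [len_eq a n, mul_inv, mul_pow]
  rw [e12, e6]

/-- ★ THE STRESS-FREE SPACING `a₀ = (A/B)^{1/6}` of the simple cubic Lennard-Jones lattice. -/
def a0 : ℝ := (epsteinA / epsteinB) ^ ((6 : ℕ)⁻¹ : ℝ)

/-- `a0_pos` (docstring added by the landing lane; see the module docstring). [formal bookkeeping] -/
theorem a0_pos : 0 < a0 := Real.rpow_pos_of_pos (div_pos epsteinA_pos epsteinB_pos) _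

/-- `a0_pow_six` (docstring added by the landing lane; see the module docstring). [formal bookkeeping] -/
theorem a0_pow_six : a0 ^ 6 = epsteinA / epsteinB :=
  Real.rpow_inv_natCast_pow (div_pos epsteinA_pos epsteinB_pos).le (by norm_num)

/-- `a0_le_one` (docstring added by the landing lane; see the module docstring). [formal bookkeeping] -/
theorem a0_le_one : a0 ≤ 1 :=
  Real.rpow_le_one (div_pos epsteinA_pos epsteinB_pos).le ((div_le_one epsteinB_pos).2 epsteinA_le_epsteinB) (by positivity)

/-- ★ At `a₀` the trace of the virial vanishes. -/
theorem S_trace_a0 : ∑ i, S a0 i i = 0 := by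
  rw [S_trace a0 a0_pos]
  have hB := epsteinB_pos.ne'
  have ha := a0_pos.ne'
  have h6 : (a0⁻¹) ^ 6 = epsteinB / epsteinA := by
    rw [inv_pow, a0_pow_six, inv_div]
  have h12 : (a0⁻¹) ^ 12 = (epsteinB / epsteinA) ^ 2 := by
    rw [← h6]; ring
  rw [h12, h6]
  field_simp
  ring

/-- ★★ Every virial entry of the cubic lattice `a₀·ℤ³` vanishes. -/
theorem S_a0_eq_zero (i j : Fin 3) : S a0 i j = 0 := by
  by_cases hij : i = j
  · subst hij
    have h3 : ∑ k, S a0 k k = 3 * S a0 0 0 := by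
      rw [Fin.sum_univ_three, S_diag_eq a0 1, S_diag_eq a0 2]; ring
    have h0 : S a0 0 0 = 0 := by have := S_trace_a0; rw [h3] at this; linarith
    rw [S_diag_eq, h0]
  · exact S_offDiag a0 hij

end Sums

/-! ## The witness -/

section Witness

/-- `inner_vec` (docstring added by the landing lane; see the module docstring). [formal bookkeeping] -/
theorem inner_vec (a : ℝ) (n : Fin 3 → ℤ) (x : E3) : inner ℝ (vec a n) x = ∑ i, ((n i : ℝ) * a) * x i := by
  simp only [PiLp.inner_apply, Real.inner_apply, vec_apply]

/-- ★★ A cubic lattice whose virial entries vanish is STRESS-FREE. -/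
theorem isStressFree_cubic (a : ℝ) (ha : 0 < a) (hS : ∀ i j, S a i j = 0) : IsStressFree (cubicRef a ha) := by
  intro u w
  rw [cubicRef_motif, Finset.sum_singleton, ← (vecEquiv a ha).tsum_eq]
  simp only [vecEquiv_apply, sub_zero, dist_zero_vec a ha, inner_vec]
  have hexp : ∀ n : N3, ljD1 (a * Real.sqrt (nsq n.1)) / (a * Real.sqrt (nsq n.1)) *
      ((∑ i, ((n.1 i : ℝ) * a) * u i) * (∑ j, ((n.1 j : ℝ) * a) * w j)) = ∑ i, ∑ j, (u i * w j) * term a i j n := fun n => by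
    rw [Finset.sum_mul_sum, Finset.mul_sum]
    refine Finset.sum_congr rfl fun i _ => ?_
    rw [Finset.mul_sum]
    refine Finset.sum_congr rfl fun j _ => ?_
    simp only [term, F, len]
    ring
  simp_rw [hexp]
  rw [Summable.tsum_finsetSum (fun i _ => summable_sum fun j _ => (summable_term a ha i j).mul_left _)]
  refine Finset.sum_eq_zero fun i _ => ?_
  rw [Summable.tsum_finsetSum (fun j _ => (summable_term a ha i j).mul_left _)]
  refine Finset.sum_eq_zero fun j _ => ?_
  rw [tsum_mul_left]
  change u i * w j * S a i j = 0
  rw [hS i j]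
  exact mul_zero _

/-- Antipodal map on `ℤ³ ∖ 0`. -/
def antipode : N3 ≃ N3 where
  toFun n := ⟨-n.1, neg_ne_zero.2 n.2⟩
  invFun n := ⟨-n.1, neg_ne_zero.2 n.2⟩
  left_inv n := Subtype.ext (neg_neg n.1)
  right_inv n := Subtype.ext (neg_neg n.1)

/-- `nsq_neg` (docstring added by the landing lane; see the module docstring). [formal bookkeeping] (dedup gate: a same-shape public twin (BEC …ParsevalShellBootstrap.ir_nsq_neg) lives in an unrelated module; kept PRIVATE here) -/
private theorem nsq_neg (n : Fin 3 → ℤ) : nsq (-n) = nsq n := by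
  simp [nsq]

/-- `vec_neg` (docstring added by the landing lane; see the module docstring). [formal bookkeeping] -/
theorem vec_neg (a : ℝ) (n : Fin 3 → ℤ) : vec a (-n) = -vec a n := by
  ext k; simp

/-- ★ The cubic lattice is FORCE-FREE at every spacing (inversion symmetry). -/
theorem isForceFree_cubic (a : ℝ) (ha : 0 < a) : IsForceFree (cubicRef a ha) := by
  intro y hy
  rw [cubicRef_motif, Finset.mem_singleton] at hy
  subst hy
  rw [← (vecEquiv a ha).tsum_eq]
  simp only [vecEquiv_apply, sub_zero, dist_zero_vec a ha]
  set g : N3 → E3 := fun n => (ljD1 (a * Real.sqrt (nsq n.1)) / (a * Real.sqrt (nsq n.1))) • vec a n.1 with hg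
  have hsum : Summable g := by
    refine Summable.of_norm_bounded ((summable_inv_len_pow a ha (by norm_num : 3 < 13)).add
      (summable_inv_len_pow a ha (by norm_num : 3 < 7))) fun n => ?_
    have hd := len_pos a ha n
    have hlen : a * Real.sqrt (nsq n.1) = len a n := rfl
    rw [hg]
    simp only [hlen]
    rw [norm_smul, Real.norm_eq_abs, abs_div, abs_of_pos hd, norm_vec a ha, hlen, div_mul_cancel₀ _ hd.ne', ljD1]
    exact (abs_add_le _ _).trans (by rw [abs_neg, abs_of_nonneg (pow_nonneg (inv_nonneg.2 hd.le) _),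
      abs_of_nonneg (pow_nonneg (inv_nonneg.2 hd.le) _)])
  have hanti : ∀ n : N3, g (antipode n) = -g n := fun n => by
    simp only [hg, antipode, Equiv.coe_fn_mk, nsq_neg, vec_neg, smul_neg]
  have h : ∑' n, g n = -∑' n, g n := by
    calc ∑' n, g n = ∑' n, g (antipode n) := (antipode.tsum_eq g).symm
      _ = ∑' n, -g n := by simp_rw [hanti]
      _ = -∑' n, g n := tsum_neg
  have h2 : (2 : ℝ) • ∑' n, g n = 0 := by rw [two_smul]; nth_rewrite 2 [h]; exact add_neg_cancel _
  exact (smul_eq_zero.1 h2).resolve_left two_ne_zero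

/-- ★★★ **THE WITNESS**: the simple cubic Lennard-Jones lattice at its stress-free spacing `a₀ = (Z(12)/Z(6))^{1/6} ≤ 1` is a periodic
configuration that is FORCE-FREE and STRESS-FREE and has a bond of length `≤ 2` at a motif point — so the hypothesis block
`IsForceFree P ∧ IsStressFree P ∧ (∃ bond ≤ 2)` of the alarm `harmStableWith_nonpos` is SATISFIABLE, and `HarmStableWith μ₀ P` is REFUTED
on a concrete `P` for every `μ₀ > 0`. -/
theorem exists_forceFree_stressFree_bond : ∃ P : PeriodicConfiguration 3, IsForceFree P ∧ IsStressFree P ∧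
    ∃ y ∈ P.motif, ∃ z ∈ P.points, z ≠ y ∧ dist y z ≤ 2 := by
  refine ⟨cubicRef a0 a0_pos, isForceFree_cubic a0 a0_pos, isStressFree_cubic a0 a0_pos S_a0_eq_zero, 0, by simp [cubicRef_motif],
    vec a0 e0.1, vec_mem_points a0 a0_pos e0.1, fun h => e0.2 ((vec_eq_zero_iff a0 a0_pos e0.1).1 h), ?_⟩
  rw [dist_zero_vec a0 a0_pos, nsq_e0, Real.sqrt_one, mul_one]
  linarith [a0_le_one]

end Witness

/-! ## The refutation of the typed hypothesis on a concrete reference (critic row 1109 (3)(d) M1) -/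

section Refute

/-- ★★★ **M1 (row 1109)**: `HarmStableWith μ₀` is REFUTED on the concrete stress-free cubic reference at every `μ₀ > 0`. -/
theorem cubicRef_not_harmStableWith {μ₀ : ℝ} (hμ : 0 < μ₀) : ¬ HarmStableWith μ₀ (cubicRef a0 a0_pos) :=
  not_harmStableWith hμ (isStressFree_cubic a0 a0_pos S_a0_eq_zero)
    ⟨0, by simp [cubicRef_motif], vec a0 e0.1, vec_mem_points a0 a0_pos e0.1, fun h => e0.2 ((vec_eq_zero_iff a0 a0_pos e0.1).1 h), by
      rw [dist_zero_vec a0 a0_pos, nsq_e0, Real.sqrt_one, mul_one]; linarith [a0_le_one]⟩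

/-- ★★★ **(V2) SATISFIABILITY WITNESS OF THE ALARM**: there is a periodic configuration that is force-free, stress-free, has a bond `≤ 2` at a
motif point, and violates `HarmStableWith μ₀` for EVERY `μ₀ > 0` — the typed stability hypothesis of generations 53–56 excludes every
equilibrium reference, not just degenerate ones. -/
theorem exists_forceFree_stressFree_not_harmStableWith : ∃ P : PeriodicConfiguration 3, IsForceFree P ∧ IsStressFree P ∧
    (∃ y ∈ P.motif, ∃ z ∈ P.points, z ≠ y ∧ dist y z ≤ 2) ∧ ∀ μ₀ : ℝ, 0 < μ₀ → ¬ HarmStableWith μ₀ P := by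
  obtain ⟨P, hF, hS, hb⟩ := exists_forceFree_stressFree_bond
  exact ⟨P, hF, hS, hb, fun μ₀ hμ => not_harmStableWith hμ hS hb⟩

/-- ★ … while the REPAIRED hypothesis is not touched by this witness: the rotation test fields pass `HarmStableModRot`'s inequality on the
cubic reference too (both sides vanish). -/
theorem cubicRef_rotField_passes (μ₀ : ℝ) (r₀ v : E3) :
    ∃ r₁ v₁ : E3, μ₀ * (∑ y ∈ (cubicRef a0 a0_pos).motif, dirichletSite (gaugedField (rotField r₀ v) r₁ v₁) (cubicRef a0 a0_pos) y) ≤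
      ∑ y ∈ (cubicRef a0 a0_pos).motif, quadSite (rotField r₀ v) (cubicRef a0 a0_pos) ∅ y :=
  harmStableModRot_test_rotField (isStressFree_cubic a0 a0_pos S_a0_eq_zero) r₀ v

end Refute

end Cubic

end Summit.AtomisticToContinuum.Crystallization.Theorems.ChargedEnergyGapChartDial

end
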